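import Literature.MathematicalPhysics.QuantumFieldTheory.Balaban1983to89.B8Eq115GaugeFixingRec
import Literature.MathematicalPhysics.QuantumFieldTheory.Balaban1983to89.B7Prop2Rec

/-!
# `Balaban1983to89.B8Ineq128Rec` — [Balaban1985RegularSpaces] Sect. F (1.128) FOR THE RECORD AVERAGE from [Balaban1985Averaging] Prop. 2 for the record
# (`B7Prop2Rec`, LEAD PEN dag-n05-e), and the ENGINE-SIGNATURE forms it unlocks: (1.130) `ineq130_global ∕ ineq130_local ∕ ineq130` and (1.15)-gauge
# fixing `gaugeFix_global ∕ ineq130_global_fixed ∕ ineq130_fixed` for the record tower — one `obtain` each over `B8Ineq130Rec.ineq130_of128` and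
# `B8Eq115GaugeFixingRec.gaugeFix_global_of_mem`

statement-level skeleton of published theorems with citation tags; proofs where landed; nothing here is a claim about the Yang–Mills mass gap

CITATION HEADER.  [6] = T. Bałaban, *Spaces of regular gauge field configurations on a lattice and gauge fixing conditions*, Commun. Math. Phys. **99**
(1985) 75–102 [Balaban1985RegularSpaces], p. 98: *«By the assumptions (1.7)–(1.9) and Proposition 2 from [3] we have |Ū₀ʲ(∂p) − 1| < 2α₀L²(Lʲη)², p ⊂ □̃^{(j)},
j = 0, 1, …, k. (1.128)»*, p. 99 (1.130), p. 78 (1.15); [3] = [Balaban1985Averaging] Prop. 2 (52)–(54) p. 26; [I] = [Balaban1987RG1] (0.3)–(0.4) pp. 252–253.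
Cell `pub-ymgap`, seat `pub-ymgap-dag-n05-d` g23 — «N05-REC» road, items R2∕R4 (LEAD PEN dag-n05-e; TOKEN RULE (T1) `avgIter ↦ avgIterZ`, `AvgClosed ↦ AvgClosedZ`,
`C0 ↦ C0Z`).  This module closes the DISPLAYED hypotheses of `B8Ineq130Rec` ((1.128) on the tower, `U1`-membership of the averages) and of
`B8Eq115GaugeFixingRec` (`G`-membership of the averages) by dag-n05-e's `B7Prop2Rec.prop2_explicitZ_lt_two ∕ avgIterZ_mem`; the statements are then the
engine's (`B8Ineq130.ineq128_global ∕ ineq130_global ∕ ineq128_local ∕ ineq130_local ∕ ineq130`, `B8Eq115GaugeFixing.gaugeFix_global ∕ ineq130_global_fixed ∕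
ineq130_fixed`) with the record substitutions and odd `L`.  `--kind proof --supports stmt-QuantumFields-20541` (K0⁷; count-neutral).

WHAT IS PROVED (sorry-free).  §1 `C0_le_C0Z` (`226 ≤ 258`: the record's Prop-1 smallness implies the engine-shaped Lemma-1 smallness used by `B8Ineq130Rec`).
§2 ★ `ineq128_global`, ★★★ `ineq130_global`.  §3 ★ `ineq128_local`, ★★★ `ineq130_local`, ★★★ `ineq130` (three members, `R₁M₁ ≤ M`, `11d < M`).  §4 ★★ `gaugeFix_global`
(record tower, `AvgClosedZ` + (1.7) in), ★ `ineq130_global_fixed`, ★★★ `ineq130_fixed` — (1.130) FOR EVERY ORBIT on the local carrier (`localGaugeZ`), the three members.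
HONEST SCOPE.  As the engine modules' (ℤᵈ towers; (1.7) pointwise-strict vs strict sup; `≤` in the first member of (1.130); explicit smallness); odd `L`; nothing of [3]∕[6]∕[I]
beyond these lines is asserted; `HThm4Rec` UNDISCHARGED; N05 ∕ N07 NOT discharged; counts unmoved; one finite 𝕋⁴ programme at fixed ε — nothing continuum ∕ ℝ⁴ ∕ OS ∕
mass gap ∕ Clay.  No `def`, no `instance`, no `notation`, no `sorry`.
-/

noncomputable section

open scoped BigOperators
open NormedSpace Finset

namespace Literature.MathematicalPhysics.QuantumFieldTheory.Balaban1983to89.B8Ineq128Rec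

open B7Prop1Explicit MatrixLog BlockAveragingZd B8Lemma1NonAbelianRecLoops B8Lemma1NonAbelianRec B8Ineq130Rec B8Eq115GaugeFixingRec
open B7Prop2Explicit (rescale rescale_apply pdev C0 C0_pos c2' le_pdev)
open B7Prop2Rec (AvgClosedZ C0Z C0Z_pos avgIterZ_mem prop2_explicitZ prop2_explicitZ_lt_two)
open B7Prop1Local (InBox AgreeOn clampCfg clampCfg_agree clampCfg_mem pdev_clampCfg_le pdevOn hol_treeWord_congr)
open B8Lemma1NonAbelian (e_nonneg)
open B8Ineq129 (ineq129 le_of_add_e_le plaqSmall_of_pdev)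
open B8Ineq130 (gaugeAct_one aLev bound130 pow_inv_sq_le_one pow_inv_sq_mul inBox_of_le axialFn_congr hol_plaqWord_congr ineq130_members)
open B7AvgGaugeCovariance (uLev uLev_apply pdev_gaugeAct)
open B8Eq115GaugeFixing (gaugeAct_mem_of gaugeAct_agree hol_treeWord_gaugeAct pdevOn_gaugeAct)

-- `Site` alone would resolve to the torus sites of `Setup.lean`; re-export the `ℤᵈ` sites of `B7Prop1Explicit`.
export B7Prop1Explicit (Site)

variable {d : ℕ}

/-! ## §1 The record's Prop-1 constant dominates the engine's -/

/-- `C₀ ≤ C₀ᶻ` (`226 ≤ 258` times the same square): the record's Prop-1 smallness `C₀ᶻ(α₀L²) ≤ ⅓` implies the engine-shaped `C₀(α₀L²) ≤ ⅓` read by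
`B8Ineq130Rec.ineq130_of128`. [cite: Balaban1985Averaging, Prop. 1 (51) p.26 (bookkeeping)] -/
theorem C0_le_C0Z (d : ℕ) : C0 d ≤ C0Z d := by
  unfold C0 C0Z
  have : (0 : ℝ) ≤ (8 * ((d : ℝ) + 1) * (d + 4)) ^ 2 := sq_nonneg _
  nlinarith

/-- `C₀ᶻ t ≤ ⅓ ⟹ C₀ t ≤ ⅓` for `t ≥ 0`. [cite: Balaban1985Averaging, Prop. 1 (51) p.26 (bookkeeping)] -/
theorem C0_mul_le_of_C0Z {d : ℕ} {t : ℝ} (ht : 0 ≤ t) (h : C0Z d * t ≤ 1 / 3) : C0 d * t ≤ 1 / 3 :=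
  (mul_le_mul_of_nonneg_right (C0_le_C0Z d) ht).trans h

variable {𝔸 : Type*} [NormedRing 𝔸] [NormOneClass 𝔸] [NormedAlgebra ℂ 𝔸] [CompleteSpace 𝔸]

/-! ## §2 (1.128) and (1.130), global carrier ((1.7) on all of `ℤᵈ`), RECORD AVERAGE -/

/-- **(1.128) FOR THE RECORD AVERAGE, global model**: if `U` is `G`-valued (`G` an `AvgClosedZ` gauge group), `L ≥ 2`, (1.7) on `Ω_{k−1} ⊃ □̃`: `sup_p |U(∂p) − 1| <
α₀L²·L^{−2k}`, and `α₀L²` is Prop.-1-small for the record (`C₀ᶻ α₀L² ≤ ⅓`, `2α₀L² ≤ c₂′`), then at depth `n = k − j ≤ k` the record average `avgIterZ L U (k − n)` has ALL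
plaquette variables within `2α₀L²·L^{−2n}` of `1`, and every level is `G`-valued — dag-n05-e's `B7Prop2Rec.prop2_explicitZ_lt_two` at level `k − n`.
[cite: Balaban1985RegularSpaces, (1.128) p.98; Balaban1985Averaging, Prop. 2 (54) p.26; Balaban1987RG1, (0.4) p.253] -/
theorem ineq128_global (L : ℕ) (hL : 2 ≤ L) {G : Subgroup 𝔸ˣ} (hG : AvgClosedZ d L G) (k : ℕ)
    (U : Site d → Fin d → 𝔸ˣ) (hU : ∀ x κ, U x κ ∈ G) {α₀ : ℝ} (hα : 0 < α₀)
    (hα3 : C0Z d * (α₀ * (L : ℝ) ^ 2) ≤ 1 / 3) (hα2 : 2 * (α₀ * (L : ℝ) ^ 2) ≤ c2' d L)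
    (h17 : pdev U < α₀ * (L : ℝ) ^ 2 * (((L : ℝ) ^ k)⁻¹) ^ 2) (n : ℕ) (hn : n ≤ k) :
    pdev (avgIterZ L U (k - n)) < aLev α₀ L n ∧ ∀ j ≤ k - n, ∀ x μ, avgIterZ L U j x μ ∈ G := by
  have hL1 : 1 ≤ L := le_trans (by norm_num) hL
  have hq1 := pow_inv_sq_le_one hL1 n
  have hαpos : 0 < α₀ * (L : ℝ) ^ 2 * (((L : ℝ) ^ n)⁻¹) ^ 2 := by positivity
  have hαle : α₀ * (L : ℝ) ^ 2 * (((L : ℝ) ^ n)⁻¹) ^ 2 ≤ α₀ * (L : ℝ) ^ 2 :=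
    mul_le_of_le_one_right (by positivity) hq1
  have hα3' : C0Z d * (α₀ * (L : ℝ) ^ 2 * (((L : ℝ) ^ n)⁻¹) ^ 2) ≤ 1 / 3 :=
    (mul_le_mul_of_nonneg_left hαle (C0Z_pos d).le).trans hα3
  have hα2' : 2 * (α₀ * (L : ℝ) ^ 2 * (((L : ℝ) ^ n)⁻¹) ^ 2) ≤ c2' d L :=
    (mul_le_mul_of_nonneg_left hαle (by norm_num)).trans hα2
  have h52 : pdev U < α₀ * (L : ℝ) ^ 2 * (((L : ℝ) ^ n)⁻¹) ^ 2 * (((L : ℝ) ^ (k - n))⁻¹) ^ 2 := by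
    rw [mul_assoc, pow_inv_sq_mul hn]; exact h17
  refine ⟨?_, (prop2_explicitZ L hL hG (k - n) U hU hαpos hα3' hα2' h52).2⟩
  calc pdev (avgIterZ L U (k - n)) < 2 * (α₀ * (L : ℝ) ^ 2 * (((L : ℝ) ^ n)⁻¹) ^ 2) :=
        prop2_explicitZ_lt_two L hL hG (k - n) U hU hαpos hα3' hα2' h52
    _ = aLev α₀ L n := by unfold aLev; ring

/-- **(1.130), FIRST MEMBER, GLOBAL CARRIER, RECORD AVERAGE — ENGINE SIGNATURE** (the twin of `B8Ineq130.ineq130_global`): (1.7) on `Ω_{k−1}` in the global form,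
`α₀L²` Prop.-1-small for the record, (1.15) (centred block contours) between all consecutive levels on the centred tower, the global axial gauge of `Ū₀′ᵏ` on
`□̃^{(k)} = [lo, hi]` at the centre `y`, and the printed smallness ⟹ `|Ū₀′^{k−n}(x, x + e_ν) − 1| ≤ 8d²L²(Σ_{m<n} L^{−2m})α₀ + (M + 4R₁M₁)dL²α₀` for every bond of
`□̃^{(k−n)}`, odd `L ≥ 3`. [cite: Balaban1985RegularSpaces, (1.130) p.99, (1.128)–(1.129) p.98, (1.15) p.78, Lemma 1 p.79; Balaban1987RG1, (0.4) p.253] -/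
theorem ineq130_global {L s : ℕ} (hLs : L = 2 * s + 1) (hL : 2 ≤ L) (hd : 1 ≤ d) {G : Subgroup 𝔸ˣ} (hG : AvgClosedZ d L G) (k : ℕ)
    (U : Site d → Fin d → 𝔸ˣ) (hU : ∀ x κ, U x κ ∈ G) {α₀ : ℝ} (hα : 0 < α₀)
    (hα3 : C0Z d * (α₀ * (L : ℝ) ^ 2) ≤ 1 / 3) (hα2 : 2 * (α₀ * (L : ℝ) ^ 2) ≤ c2' d L)
    (h17 : pdev U < α₀ * (L : ℝ) ^ 2 * (((L : ℝ) ^ k)⁻¹) ^ 2)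
    (lo hi : Site d)
    (h15 : ∀ n, n < k → ∀ z, tlo L lo n ≤ z → z ≤ thi L hi n → ∀ r : Fin d → Fin L,
      axialFn (avgIterZ L U (k - (n + 1))) ((L : ℤ) • z) ((L : ℤ) • z + offZ L r) = 1)
    {y : Site d} {h : ℕ} (hy : lo ≤ y) (hy' : y ≤ hi) (hrad : ∀ κ, y κ - lo κ ≤ h ∧ hi κ - y κ ≤ h)
    (hgax : ∀ z, lo ≤ z → z ≤ hi → hol (avgIterZ L U k) y (treeWord (z - y)) = 1)
    {M R₁ M₁ : ℝ} (hside : 2 * (h : ℝ) ≤ M + 4 * R₁ * M₁)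
    (hsmall : 11 * (d : ℝ) ^ 2 * (L : ℝ) ^ 2 * α₀ + (M + 4 * R₁ * M₁) * d * (L : ℝ) ^ 2 * α₀ ≤ 1 / 6)
    (n : ℕ) (hn : n ≤ k) (x : Site d) (ν : Fin d) (hx : tlo L lo n ≤ x) (hxν : x + e ν ≤ thi L hi n) :
    ‖((avgIterZ L U (k - n) x ν : 𝔸ˣ) : 𝔸) - 1‖ ≤ bound130 d L α₀ M R₁ M₁ n := by
  have h128 := fun m hm => ineq128_global L hL hG k U hU hα hα3 hα2 h17 m hm
  have hmemG := (h128 0 (Nat.zero_le k)).2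
  have hmem : ∀ j ≤ k, ∀ x μ, avgIterZ L U j x μ ∈ U1 𝔸 := fun j hj x μ =>
    hG.le_U1 (hmemG j (by simpa using hj) x μ)
  exact ineq130_of128 hLs hL hd k U hα (C0_mul_le_of_C0Z (by positivity) hα3) lo hi hmem
    (fun m hm => plaqSmall_of_pdev (hmem _ (by omega)) (h128 m hm).1.le _ _) h15 hy hy' hrad hgax hside hsmall n hn x ν hx hxν

/-! ## §3 (1.128) and (1.130), local carrier ((1.7) on the finest cube only), RECORD AVERAGE -/

/-- **(1.128), LOCAL CARRIER, RECORD AVERAGE** — (1.7) assumed on the unit plaquettes of the CENTRED finest cube `□̃ = [tlo k, thi k]` ONLY: for every depth `n ≤ k` and every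
plaquette `p ⊂ □̃^{(k−n)}`, `|Ū₀^{k−n}(∂p) − 1| < 2α₀L²·L^{−2n}`.  Proof: the clamped extension of `U₀|□̃` satisfies (1.7) everywhere, `ineq128_global` applies to it, and its
record averages agree with those of `U₀` on the centred tower (`B8Ineq130Rec.agree_level`). [cite: Balaban1985RegularSpaces, (1.128) p.98; Balaban1985Averaging, Prop. 2 p.26 (locality sentence); Balaban1987RG1, (0.4) p.253] -/
theorem ineq128_local {L s : ℕ} (hLs : L = 2 * s + 1) (hL : 2 ≤ L) {G : Subgroup 𝔸ˣ} (hG : AvgClosedZ d L G) (k : ℕ)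
    (U : Site d → Fin d → 𝔸ˣ) (hU : ∀ x κ, U x κ ∈ G) {α₀ : ℝ} (hα : 0 < α₀)
    (hα3 : C0Z d * (α₀ * (L : ℝ) ^ 2) ≤ 1 / 3) (hα2 : 2 * (α₀ * (L : ℝ) ^ 2) ≤ c2' d L)
    (lo hi : Site d) (hlohi : lo ≤ hi)
    (h17 : pdevOn (tlo L lo k) (thi L hi k) U < α₀ * (L : ℝ) ^ 2 * (((L : ℝ) ^ k)⁻¹) ^ 2)
    (n : ℕ) (hn : n ≤ k) (z : Site d) (μ ν : Fin d) (hz : tlo L lo n ≤ z) (hz' : z + e μ + e ν ≤ thi L hi n) :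
    ‖((hol (avgIterZ L U (k - n)) z (plaqWord μ ν) : 𝔸ˣ) : 𝔸) - 1‖ < aLev α₀ L n := by
  have hUU : ∀ x κ, U x κ ∈ U1 𝔸 := fun x κ => hG.le_U1 (hU x κ)
  have hkk : ∀ i, tlo L lo k i ≤ thi L hi k i := tlo_le_thi L hlohi k
  have hU' : ∀ x κ, clampCfg (tlo L lo k) (thi L hi k) U x κ ∈ G := clampCfg_mem hU
  have h17' : pdev (clampCfg (tlo L lo k) (thi L hi k) U) < α₀ * (L : ℝ) ^ 2 * (((L : ℝ) ^ k)⁻¹) ^ 2 :=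
    (pdev_clampCfg_le hkk hUU).trans_lt h17
  have h128 := ineq128_global L hL hG k _ hU' hα hα3 hα2 h17' n hn
  have hW : ∀ x κ, avgIterZ L (clampCfg (tlo L lo k) (thi L hi k) U) (k - n) x κ ∈ U1 𝔸 := fun x κ =>
    hG.le_U1 (h128.2 (k - n) le_rfl x κ)
  have hag : AgreeOn (tlo L lo n) (thi L hi n) (avgIterZ L (clampCfg (tlo L lo k) (thi L hi k) U) (k - n))
      (avgIterZ L U (k - n)) :=
    agree_level hLs (k - n) n (by rw [show n + (k - n) = k by omega]; exact clampCfg_agree U)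
  have hzz : z ≤ z + e μ + e ν := (le_add_of_nonneg_right (e_nonneg μ)).trans (le_add_of_nonneg_right (e_nonneg ν))
  rw [← hol_plaqWord_congr hag z μ ν (inBox_of_le hz (hzz.trans hz')) (inBox_of_le (hz.trans hzz) hz')]
  exact (le_pdev hW z μ ν).trans_lt h128.1

/-- **(1.130), FIRST MEMBER, LOCAL CARRIER, RECORD AVERAGE — ENGINE SIGNATURE** (twin of `B8Ineq130.ineq130_local`): as `ineq130_global`, with (1.7) assumed on the unit
plaquettes of the centred cube `□̃` ONLY. [cite: Balaban1985RegularSpaces, (1.130) p.99, p.98; Balaban1987RG1, (0.4) p.253] -/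
theorem ineq130_local {L s : ℕ} (hLs : L = 2 * s + 1) (hL : 2 ≤ L) (hd : 1 ≤ d) {G : Subgroup 𝔸ˣ} (hG : AvgClosedZ d L G) (k : ℕ)
    (U : Site d → Fin d → 𝔸ˣ) (hU : ∀ x κ, U x κ ∈ G) {α₀ : ℝ} (hα : 0 < α₀)
    (hα3 : C0Z d * (α₀ * (L : ℝ) ^ 2) ≤ 1 / 3) (hα2 : 2 * (α₀ * (L : ℝ) ^ 2) ≤ c2' d L)
    (lo hi : Site d) (hlohi : lo ≤ hi)
    (h17 : pdevOn (tlo L lo k) (thi L hi k) U < α₀ * (L : ℝ) ^ 2 * (((L : ℝ) ^ k)⁻¹) ^ 2)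
    (h15 : ∀ n, n < k → ∀ z, tlo L lo n ≤ z → z ≤ thi L hi n → ∀ r : Fin d → Fin L,
      axialFn (avgIterZ L U (k - (n + 1))) ((L : ℤ) • z) ((L : ℤ) • z + offZ L r) = 1)
    {y : Site d} {h : ℕ} (hy : lo ≤ y) (hy' : y ≤ hi) (hrad : ∀ κ, y κ - lo κ ≤ h ∧ hi κ - y κ ≤ h)
    (hgax : ∀ z, lo ≤ z → z ≤ hi → hol (avgIterZ L U k) y (treeWord (z - y)) = 1)
    {M R₁ M₁ : ℝ} (hside : 2 * (h : ℝ) ≤ M + 4 * R₁ * M₁)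
    (hsmall : 11 * (d : ℝ) ^ 2 * (L : ℝ) ^ 2 * α₀ + (M + 4 * R₁ * M₁) * d * (L : ℝ) ^ 2 * α₀ ≤ 1 / 6)
    (n : ℕ) (hn : n ≤ k) (x : Site d) (ν : Fin d) (hx : tlo L lo n ≤ x) (hxν : x + e ν ≤ thi L hi n) :
    ‖((avgIterZ L U (k - n) x ν : 𝔸ˣ) : 𝔸) - 1‖ ≤ bound130 d L α₀ M R₁ M₁ n := by
  have hUU : ∀ x κ, U x κ ∈ U1 𝔸 := fun x κ => hG.le_U1 (hU x κ)
  have hkk : ∀ i, tlo L lo k i ≤ thi L hi k i := tlo_le_thi L hlohi k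
  have hU' : ∀ x κ, clampCfg (tlo L lo k) (thi L hi k) U x κ ∈ G := clampCfg_mem hU
  have h17' : pdev (clampCfg (tlo L lo k) (thi L hi k) U) < α₀ * (L : ℝ) ^ 2 * (((L : ℝ) ^ k)⁻¹) ^ 2 :=
    (pdev_clampCfg_le hkk hUU).trans_lt h17
  have hA : ∀ j m, m + j = k → AgreeOn (tlo L lo m) (thi L hi m)
      (avgIterZ L (clampCfg (tlo L lo k) (thi L hi k) U) j) (avgIterZ L U j) := fun j m hmj =>
    agree_level hLs j m (by rw [hmj]; exact clampCfg_agree U)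
  have h15' : ∀ n, n < k → ∀ z, tlo L lo n ≤ z → z ≤ thi L hi n → ∀ r : Fin d → Fin L,
      axialFn (avgIterZ L (clampCfg (tlo L lo k) (thi L hi k) U) (k - (n + 1))) ((L : ℤ) • z)
        ((L : ℤ) • z + offZ L r) = 1 := by
    intro n hn z hz hz' r
    obtain ⟨h1, h2⟩ := block_mem hLs hz hz' r
    obtain ⟨h3, h4⟩ := smul_mem (L := L) hz hz'
    rw [axialFn_congr (hA (k - (n + 1)) (n + 1) (by omega)) _ _ (inBox_of_le h3 h4) (inBox_of_le h1 h2)]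
    exact h15 n hn z hz hz' r
  have hgax' : ∀ z, lo ≤ z → z ≤ hi →
      hol (avgIterZ L (clampCfg (tlo L lo k) (thi L hi k) U) k) y (treeWord (z - y)) = 1 := by
    intro z hz hz'
    have hag := hA k 0 (by simp)
    rw [hol_treeWord_congr hag y (z - y) (inBox_of_le hy hy') (by rw [add_sub_cancel]; exact inBox_of_le hz hz')]
    exact hgax z hz hz'
  have hmain := ineq130_global hLs hL hd hG k _ hU' hα hα3 hα2 h17' lo hi h15' hy hy' hrad hgax' hside hsmall
    n hn x ν hx hxν
  rwa [hA (k - n) n (by omega) x ν (inBox_of_le hx (le_of_add_e_le hxν))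
    (inBox_of_le (hx.trans (le_add_of_nonneg_right (e_nonneg ν))) hxν)] at hmain

/-- **(1.130) ALL THREE MEMBERS, LOCAL CARRIER, RECORD AVERAGE, printed constants** (twin of `B8Ineq130.ineq130`): under the hypotheses of `ineq130_local` and `R₁M₁ ≤ M`,
`11d < M`: `|Ū₀′^{k−n}(x, x+e_ν) − 1| ≤ 8d²L²(Σ_{m<n}L^{−2m})α₀ + (M + 4R₁M₁)dL²α₀ < 11d²L²α₀ + 5dL²Mα₀ < 6dL²Mα₀` — in particular (1.133) for the record.
[cite: Balaban1985RegularSpaces, (1.130) p.99, (1.133) p.99; Balaban1987RG1, (0.4) p.253] -/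
theorem ineq130 {L s : ℕ} (hLs : L = 2 * s + 1) (hL : 2 ≤ L) (hd : 1 ≤ d) {G : Subgroup 𝔸ˣ} (hG : AvgClosedZ d L G) (k : ℕ)
    (U : Site d → Fin d → 𝔸ˣ) (hU : ∀ x κ, U x κ ∈ G) {α₀ : ℝ} (hα : 0 < α₀)
    (hα3 : C0Z d * (α₀ * (L : ℝ) ^ 2) ≤ 1 / 3) (hα2 : 2 * (α₀ * (L : ℝ) ^ 2) ≤ c2' d L)
    (lo hi : Site d) (hlohi : lo ≤ hi)
    (h17 : pdevOn (tlo L lo k) (thi L hi k) U < α₀ * (L : ℝ) ^ 2 * (((L : ℝ) ^ k)⁻¹) ^ 2)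
    (h15 : ∀ n, n < k → ∀ z, tlo L lo n ≤ z → z ≤ thi L hi n → ∀ r : Fin d → Fin L,
      axialFn (avgIterZ L U (k - (n + 1))) ((L : ℤ) • z) ((L : ℤ) • z + offZ L r) = 1)
    {y : Site d} {h : ℕ} (hy : lo ≤ y) (hy' : y ≤ hi) (hrad : ∀ κ, y κ - lo κ ≤ h ∧ hi κ - y κ ≤ h)
    (hgax : ∀ z, lo ≤ z → z ≤ hi → hol (avgIterZ L U k) y (treeWord (z - y)) = 1)
    {M R₁ M₁ : ℝ} (hside : 2 * (h : ℝ) ≤ M + 4 * R₁ * M₁) (hRM : R₁ * M₁ ≤ M) (hM : 11 * (d : ℝ) < M)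
    (hsmall : 11 * (d : ℝ) ^ 2 * (L : ℝ) ^ 2 * α₀ + (M + 4 * R₁ * M₁) * d * (L : ℝ) ^ 2 * α₀ ≤ 1 / 6)
    (n : ℕ) (hn : n ≤ k) (x : Site d) (ν : Fin d) (hx : tlo L lo n ≤ x) (hxν : x + e ν ≤ thi L hi n) :
    ‖((avgIterZ L U (k - n) x ν : 𝔸ˣ) : 𝔸) - 1‖ ≤ bound130 d L α₀ M R₁ M₁ n ∧
      bound130 d L α₀ M R₁ M₁ n < 11 * (d : ℝ) ^ 2 * (L : ℝ) ^ 2 * α₀ + 5 * d * (L : ℝ) ^ 2 * M * α₀ ∧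
      11 * (d : ℝ) ^ 2 * (L : ℝ) ^ 2 * α₀ + 5 * d * (L : ℝ) ^ 2 * M * α₀ < 6 * d * (L : ℝ) ^ 2 * M * α₀ ∧
      ‖((avgIterZ L U (k - n) x ν : 𝔸ˣ) : 𝔸) - 1‖ < 6 * d * (L : ℝ) ^ 2 * M * α₀ := by
  have h1 := ineq130_local hLs hL hd hG k U hU hα hα3 hα2 lo hi hlohi h17 h15 hy hy' hrad hgax hside hsmall n hn x ν hx hxν
  have h2 := ineq130_members hd hL hα hRM hM n
  exact ⟨h1, h2.1, h2.2, lt_of_le_of_lt h1 (h2.1.trans h2.2)⟩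

/-! ## §4 The (1.15)-gauge fixing of the record tower from (1.7) + `AvgClosedZ` — ENGINE SIGNATURES -/

/-- **EXISTENCE OF THE GAUGE (p. 78 (1.15) + p. 98), RECORD TOWER, GLOBAL CARRIER — ENGINE SIGNATURE** (twin of `B8Eq115GaugeFixing.gaugeFix_global`): `G` an `AvgClosedZ`
gauge group, odd `L ≥ 3`, `U` `G`-valued with (1.7) `sup_p |U(∂p) − 1| < α₀L²·L^{−2k}` and `α₀L²` Prop.-1-small for the record.  Then for `u := towerGaugeZ L U k y` and
`U′ := U^{u}`: `u` and `U′` are `G`-valued; `sup_p |U′(∂p) − 1| = sup_p |U(∂p) − 1|`; `Ū′ʲ = (Ūʲ)^{u∘(Lʲ·)}` for every `j`; (1.15) holds for `U′` between all consecutive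
levels at every centred block; and `Ū′ᵏ(Γ_{y,z}) = 1` for all `z`. [cite: Balaban1985RegularSpaces, (1.15) p.78, p.98; Balaban1985Averaging, Prop. 2 p.26; Balaban1987RG1, (0.4) p.253] -/
theorem gaugeFix_global {L s : ℕ} (hLs : L = 2 * s + 1) (hL : 2 ≤ L) {G : Subgroup 𝔸ˣ} (hG : AvgClosedZ d L G) (k : ℕ)
    (U : Site d → Fin d → 𝔸ˣ) (hU : ∀ x κ, U x κ ∈ G) {α₀ : ℝ} (hα : 0 < α₀)
    (hα3 : C0Z d * (α₀ * (L : ℝ) ^ 2) ≤ 1 / 3) (hα2 : 2 * (α₀ * (L : ℝ) ^ 2) ≤ c2' d L)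
    (h17 : pdev U < α₀ * (L : ℝ) ^ 2 * (((L : ℝ) ^ k)⁻¹) ^ 2) (y : Site d) :
    (∀ x, towerGaugeZ L U k y x ∈ G) ∧
    (∀ x κ, gaugeAct (towerGaugeZ L U k y) U x κ ∈ G) ∧
    pdev (gaugeAct (towerGaugeZ L U k y) U) = pdev U ∧
    (∀ j, avgIterZ L (gaugeAct (towerGaugeZ L U k y) U) j =
      gaugeAct (uLev L (towerGaugeZ L U k y) j) (avgIterZ L U j)) ∧
    (∀ n, n < k → ∀ (z : Site d) (r : Fin d → Fin L),
      axialFn (avgIterZ L (gaugeAct (towerGaugeZ L U k y) U) (k - (n + 1))) ((L : ℤ) • z)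
        ((L : ℤ) • z + offZ L r) = 1) ∧
    (∀ z, hol (avgIterZ L (gaugeAct (towerGaugeZ L U k y) U) k) y (treeWord (z - y)) = 1) := by
  have hα' : 0 < α₀ * (L : ℝ) ^ 2 := by positivity
  have hmemG : ∀ j ≤ k, ∀ x μ, avgIterZ L U j x μ ∈ G := avgIterZ_mem L hL hG k U hU hα' hα3 hα2 h17
  exact gaugeFix_global_of_mem hLs hG.le_U1 k U hU hmemG y

/-- **(1.130), FIRST MEMBER, GLOBAL CARRIER, FOR EVERY ORBIT, RECORD TOWER — ENGINE SIGNATURE** (twin of `B8Eq115GaugeFixing.ineq130_global_fixed`): the gauge-fixed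
`U₀′ := U₀^{u}`, `u = towerGaugeZ L U₀ k y`, satisfies the first member of (1.130) on every bond of `□̃^{(k−n)}` — `ineq130_global` with its gauge hypotheses supplied
by `gaugeFix_global`. [cite: Balaban1985RegularSpaces, (1.130) p.99, p.98, (1.15) p.78; Balaban1987RG1, (0.4) p.253] -/
theorem ineq130_global_fixed {L s : ℕ} (hLs : L = 2 * s + 1) (hL : 2 ≤ L) (hd : 1 ≤ d) {G : Subgroup 𝔸ˣ} (hG : AvgClosedZ d L G)
    (k : ℕ) (U : Site d → Fin d → 𝔸ˣ) (hU : ∀ x κ, U x κ ∈ G) {α₀ : ℝ} (hα : 0 < α₀)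
    (hα3 : C0Z d * (α₀ * (L : ℝ) ^ 2) ≤ 1 / 3) (hα2 : 2 * (α₀ * (L : ℝ) ^ 2) ≤ c2' d L)
    (h17 : pdev U < α₀ * (L : ℝ) ^ 2 * (((L : ℝ) ^ k)⁻¹) ^ 2) (lo hi : Site d)
    {y : Site d} {h : ℕ} (hy : lo ≤ y) (hy' : y ≤ hi) (hrad : ∀ κ, y κ - lo κ ≤ h ∧ hi κ - y κ ≤ h)
    {M R₁ M₁ : ℝ} (hside : 2 * (h : ℝ) ≤ M + 4 * R₁ * M₁)
    (hsmall : 11 * (d : ℝ) ^ 2 * (L : ℝ) ^ 2 * α₀ + (M + 4 * R₁ * M₁) * d * (L : ℝ) ^ 2 * α₀ ≤ 1 / 6)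
    (n : ℕ) (hn : n ≤ k) (x : Site d) (ν : Fin d) (hx : tlo L lo n ≤ x) (hxν : x + e ν ≤ thi L hi n) :
    ‖((avgIterZ L (gaugeAct (towerGaugeZ L U k y) U) (k - n) x ν : 𝔸ˣ) : 𝔸) - 1‖ ≤ bound130 d L α₀ M R₁ M₁ n := by
  obtain ⟨-, hU', hpd, -, h15, hgax⟩ := gaugeFix_global hLs hL hG k U hU hα hα3 hα2 h17 y
  exact ineq130_global hLs hL hd hG k _ hU' hα hα3 hα2 (by rw [hpd]; exact h17) lo hi
    (fun n hn z _ _ r => h15 n hn z r) hy hy' hrad (fun z _ _ => hgax z) hside hsmall n hn x ν hx hxν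

/-- **(1.130), ALL THREE MEMBERS, LOCAL CARRIER, FOR EVERY ORBIT, RECORD TOWER — ENGINE SIGNATURE** (twin of `B8Eq115GaugeFixing.ineq130_fixed`): `G` `AvgClosedZ`, odd `L ≥ 3`,
`d ≥ 1`, `U₀` `G`-valued, (1.7) on the unit plaquettes of the centred cube `□̃ = [tlo k, thi k]` ONLY, the explicit smallness, the top cube `[lo, hi]` with centre `y`, `|x − y|_∞ ≤ h`,
`2h ≤ M + 4R₁M₁`, `R₁M₁ ≤ M`, `11d < M`.  For `u := localGaugeZ L lo hi U₀ k y` and `U₀′ := U₀^{u}`: `u` is `G`-valued; `U₀′` satisfies (1.15) (centred block contours) between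
consecutive levels on the tower and the global axial gauge of `Ū₀′ᵏ` on `□̃^{(k)}` at `y`; and for every `n ≤ k` and bond `⟨x, x + e_ν⟩ ⊂ □̃^{(k−n)}`:
`|Ū₀′^{k−n}(x, x + e_ν) − 1| ≤ bound130 < 11d²L²α₀ + 5dL²Mα₀ < 6dL²Mα₀`. [cite: Balaban1985RegularSpaces, (1.130) p.99, p.98, (1.15) p.78; Balaban1987RG1, (0.4) p.253] -/
theorem ineq130_fixed {L s : ℕ} (hLs : L = 2 * s + 1) (hL : 2 ≤ L) (hd : 1 ≤ d) {G : Subgroup 𝔸ˣ} (hG : AvgClosedZ d L G) (k : ℕ)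
    (U : Site d → Fin d → 𝔸ˣ) (hU : ∀ x κ, U x κ ∈ G) {α₀ : ℝ} (hα : 0 < α₀)
    (hα3 : C0Z d * (α₀ * (L : ℝ) ^ 2) ≤ 1 / 3) (hα2 : 2 * (α₀ * (L : ℝ) ^ 2) ≤ c2' d L)
    (lo hi : Site d) (hlohi : lo ≤ hi)
    (h17 : pdevOn (tlo L lo k) (thi L hi k) U < α₀ * (L : ℝ) ^ 2 * (((L : ℝ) ^ k)⁻¹) ^ 2)
    {y : Site d} {h : ℕ} (hy : lo ≤ y) (hy' : y ≤ hi) (hrad : ∀ κ, y κ - lo κ ≤ h ∧ hi κ - y κ ≤ h)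
    {M R₁ M₁ : ℝ} (hside : 2 * (h : ℝ) ≤ M + 4 * R₁ * M₁) (hRM : R₁ * M₁ ≤ M) (hM : 11 * (d : ℝ) < M)
    (hsmall : 11 * (d : ℝ) ^ 2 * (L : ℝ) ^ 2 * α₀ + (M + 4 * R₁ * M₁) * d * (L : ℝ) ^ 2 * α₀ ≤ 1 / 6) :
    (∀ x, localGaugeZ L lo hi U k y x ∈ G) ∧
    (∀ n, n < k → ∀ z, tlo L lo n ≤ z → z ≤ thi L hi n → ∀ r : Fin d → Fin L,
      axialFn (avgIterZ L (gaugeAct (localGaugeZ L lo hi U k y) U) (k - (n + 1))) ((L : ℤ) • z)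
        ((L : ℤ) • z + offZ L r) = 1) ∧
    (∀ z, lo ≤ z → z ≤ hi →
      hol (avgIterZ L (gaugeAct (localGaugeZ L lo hi U k y) U) k) y (treeWord (z - y)) = 1) ∧
    ∀ (n : ℕ), n ≤ k → ∀ (x : Site d) (ν : Fin d), tlo L lo n ≤ x → x + e ν ≤ thi L hi n →
      ‖((avgIterZ L (gaugeAct (localGaugeZ L lo hi U k y) U) (k - n) x ν : 𝔸ˣ) : 𝔸) - 1‖ ≤
          bound130 d L α₀ M R₁ M₁ n ∧
        bound130 d L α₀ M R₁ M₁ n < 11 * (d : ℝ) ^ 2 * (L : ℝ) ^ 2 * α₀ + 5 * d * (L : ℝ) ^ 2 * M * α₀ ∧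
        11 * (d : ℝ) ^ 2 * (L : ℝ) ^ 2 * α₀ + 5 * d * (L : ℝ) ^ 2 * M * α₀ < 6 * d * (L : ℝ) ^ 2 * M * α₀ ∧
        ‖((avgIterZ L (gaugeAct (localGaugeZ L lo hi U k y) U) (k - n) x ν : 𝔸ˣ) : 𝔸) - 1‖ <
          6 * d * (L : ℝ) ^ 2 * M * α₀ := by
  have hUU : ∀ x κ, U x κ ∈ U1 𝔸 := fun x κ => hG.le_U1 (hU x κ)
  have hkk : ∀ i, tlo L lo k i ≤ thi L hi k i := tlo_le_thi L hlohi k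
  set Uc := clampCfg (tlo L lo k) (thi L hi k) U with hUc
  have hUcG : ∀ x κ, Uc x κ ∈ G := clampCfg_mem hU
  have h17c : pdev Uc < α₀ * (L : ℝ) ^ 2 * (((L : ℝ) ^ k)⁻¹) ^ 2 := (pdev_clampCfg_le hkk hUU).trans_lt h17
  obtain ⟨huG, -, -, -, h15c, hgaxc⟩ := gaugeFix_global hLs hL hG k Uc hUcG hα hα3 hα2 h17c y
  have huU : ∀ x, localGaugeZ L lo hi U k y x ∈ U1 𝔸 := fun x => hG.le_U1 (huG x)
  have hU' : ∀ x κ, gaugeAct (localGaugeZ L lo hi U k y) U x κ ∈ G := gaugeAct_mem_of hU huG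
  have hA : ∀ j m, m + j = k → AgreeOn (tlo L lo m) (thi L hi m)
      (avgIterZ L (gaugeAct (localGaugeZ L lo hi U k y) Uc) j)
      (avgIterZ L (gaugeAct (localGaugeZ L lo hi U k y) U) j) := fun j m hmj =>
    agree_level hLs j m (by rw [hmj]; exact gaugeAct_agree (clampCfg_agree U) _)
  have h15' : ∀ n, n < k → ∀ z, tlo L lo n ≤ z → z ≤ thi L hi n → ∀ r : Fin d → Fin L,
      axialFn (avgIterZ L (gaugeAct (localGaugeZ L lo hi U k y) U) (k - (n + 1))) ((L : ℤ) • z)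
        ((L : ℤ) • z + offZ L r) = 1 := by
    intro n hn z hz hz' r
    obtain ⟨h1, h2⟩ := block_mem hLs hz hz' r
    obtain ⟨h3, h4⟩ := smul_mem (L := L) hz hz'
    rw [← axialFn_congr (hA (k - (n + 1)) (n + 1) (by omega)) _ _ (inBox_of_le h3 h4) (inBox_of_le h1 h2)]
    exact h15c n hn z r
  have hgax' : ∀ z, lo ≤ z → z ≤ hi →
      hol (avgIterZ L (gaugeAct (localGaugeZ L lo hi U k y) U) k) y (treeWord (z - y)) = 1 := by
    intro z hz hz'
    have hag := hA k 0 (by simp)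
    rw [← hol_treeWord_congr hag y (z - y) (inBox_of_le hy hy')
      (by rw [add_sub_cancel]; exact inBox_of_le hz hz')]
    exact hgaxc z
  have h17' : pdevOn (tlo L lo k) (thi L hi k) (gaugeAct (localGaugeZ L lo hi U k y) U) <
      α₀ * (L : ℝ) ^ 2 * (((L : ℝ) ^ k)⁻¹) ^ 2 := by
    rw [pdevOn_gaugeAct huU]; exact h17
  exact ⟨huG, h15', hgax', fun n hn x ν hx hxν => ineq130 hLs hL hd hG k _ hU' hα hα3 hα2 lo hi hlohi h17' h15'
    hy hy' hrad hgax' hside hRM hM hsmall n hn x ν hx hxν⟩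

end Literature.MathematicalPhysics.QuantumFieldTheory.Balaban1983to89.B8Ineq128Rec

/-! ## Axiom audit (gate whitelist: `propext`, `Classical.choice`, `Quot.sound`) -/
#print axioms Literature.MathematicalPhysics.QuantumFieldTheory.Balaban1983to89.B8Ineq128Rec.ineq130
#print axioms Literature.MathematicalPhysics.QuantumFieldTheory.Balaban1983to89.B8Ineq128Rec.ineq130_fixed
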